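import Mathlib
import Literature.AlgebraicGeometry.Resolution.RegularLocalRingsNormal
import Literature.RingTheory.KrullDimension.AffineDimension

/-!
# Route `RadicialJung`, crux `CleanModelsSuffice` (stmt-ResolutionOfSingularities-15883), line `Sketch`, skeleton v3:
# stub `stub_rootOverring` — the `p`-th root overring of a regular local ring is regular

Registered stub `stub_rootOverring` of the skeleton of
`Summit.ResolutionOfSingularities.ResolutionOfSingularities.Theses.RadicialJung.CleanModelsSuffice`.
Let `(A, 𝔪)` be a regular local ring of dimension `d`, embedded in a field `Ω`, with a minimal
system of generators `tw₁, …, tw_d` of `𝔪`; let `ι : Fin s ↪ Fin d` single out some of them,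
`t_i = tw (ι i)`, and let `τ_i ∈ Ω` with `τ_i ^ p = t_i` (`p` prime). For the `A`-subalgebra
`Ã = A[τ_1, …, τ_s] ⊆ Ω` we prove (`stub_rootOverring`):

* `Ã` is, as an `A`-module, the span of the `p^s` monomials `∏ τ_i^{e_i}`, `0 ≤ e_i < p`
  (`rootOverring_toSubmodule_eq_span`: the span contains `1`, the `τ_j`, and is closed under
  multiplication since `τ^e · τ^f = (∏ t_i^{⌊(e_i+f_i)/p⌋}) · τ^{(e+f) mod p}`,
  `rootOverring_monomial_mul`); hence `Ã` is module-finite over `A`;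
* every maximal ideal of `Ã` equals `I = (τ_1, …, τ_s, tw_k : k ∉ ι)` — an ideal generated by
  `d` elements (`rootOverring_eq_span_of_isMaximal`: a maximal ideal `M` contracts to `𝔪`
  by integrality, so contains `τ_i` (as `τ_i^p = t_i ∈ 𝔪`) and the `tw_k`; conversely every
  element of `Ã` is congruent modulo `I` to an element of `A`,
  `rootOverring_exists_sub_algebraMap_mem`, which lies in `M ∩ A = 𝔪 ⊆ I`); so `Ã` is local
  with maximal ideal `I`;
* `dim Ã = dim A = d` (`A ⊆ Ã` integral and injective, `ringKrullDim_eq_of_isIntegral`), so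
  `Ã` is a regular local ring (`IsRegularLocalRing.of_spanFinrank_maximalIdeal_le`), hence
  integrally closed (Matsumura 19.4, `isIntegrallyClosed_of_isRegularLocalRing`).

Sources: standard (Kummer theory in the parameters of a regular local ring; cf. the proof of
Cossart–Piltant 2008, Lemma 9.4, formalised for ALL parameters and a valuation centre in
`Literature.AlgebraicGeometry.Resolution.isRegularLocalRing_localization_adjoin_roots`, whose
bookkeeping is adapted here). Not here: the `p`-independence of regular parameters and the
Kummer descent consuming this statement (sibling stubs).
-/

noncomputable section

set_option linter.dupNamespace false -- mandated namespace of this single-conjunct summit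

open IsLocalRing

namespace Summit.ResolutionOfSingularities.ResolutionOfSingularities.Theorems.RadicialJung.CleanModelsSuffice

variable {A Ω : Type} [CommRing A] [Field Ω] [Algebra A Ω]

/-- Multiplication table of the `p`-th root monomials: if `τ_i^p = t_i` then
`τ^e · τ^f = (∏ t_i^{⌊(e_i + f_i)/p⌋}) · τ^{(e + f) mod p}`. [folklore] -/
theorem rootOverring_monomial_mul {s : ℕ} (p : ℕ) (t : Fin s → A) (τ : Fin s → Ω)
    (hτ : ∀ i, τ i ^ p = algebraMap A Ω (t i)) (e f : Fin s → ℕ) :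
    (∏ i, τ i ^ e i) * ∏ i, τ i ^ f i =
      algebraMap A Ω (∏ i, t i ^ ((e i + f i) / p)) * ∏ i, τ i ^ ((e i + f i) % p) := by
  rw [← Finset.prod_mul_distrib, map_prod, ← Finset.prod_mul_distrib]
  refine Finset.prod_congr rfl fun i _ => ?_
  rw [← pow_add, map_pow, ← hτ i, ← pow_mul, ← pow_add, Nat.div_add_mod]

/-- **The root overring is spanned by the monomials.** If `τ_i ∈ Ω` satisfy `τ_i^p = t_i ∈ A`
(`p` prime, `i < s`), then `A[τ_1, …, τ_s] ⊆ Ω` is, as an `A`-submodule of `Ω`, the span of the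
`p^s` monomials `∏ τ_i^{e_i}`, `0 ≤ e_i < p`. [folklore] -/
theorem rootOverring_toSubmodule_eq_span {s : ℕ} (p : ℕ) (hp : p.Prime) (t : Fin s → A)
    (τ : Fin s → Ω) (hτ : ∀ i, τ i ^ p = algebraMap A Ω (t i)) :
    Subalgebra.toSubmodule (Algebra.adjoin A (Set.range τ)) =
      Submodule.span A (Set.range fun e : Fin s → Fin p => ∏ i, τ i ^ (e i : ℕ)) := by
  set M : Submodule A Ω :=
    Submodule.span A (Set.range fun e : Fin s → Fin p => ∏ i, τ i ^ (e i : ℕ)) with hM_def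
  have h1p := hp.one_lt
  -- products of monomials lie in the span
  have hmul : ∀ e f : Fin s → Fin p,
      (∏ i, τ i ^ (e i : ℕ)) * ∏ i, τ i ^ (f i : ℕ) ∈ M := by
    intro e f
    rw [rootOverring_monomial_mul p t τ hτ, ← Algebra.smul_def]
    exact M.smul_mem _ (Submodule.subset_span
      ⟨fun i => ⟨((e i : ℕ) + f i) % p, Nat.mod_lt _ hp.pos⟩, rfl⟩)
  have hMM : M * M ≤ M := by
    rw [hM_def, Submodule.span_mul_span, Submodule.span_le]
    rintro _ ⟨_, ⟨e, rfl⟩, _, ⟨f, rfl⟩, rfl⟩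
    exact hmul e f
  -- `1` and the `τ_j` are monomials
  have h1 : (1 : Ω) ∈ M := by
    refine Submodule.subset_span ⟨fun _ => ⟨0, hp.pos⟩, ?_⟩
    simp
  have hτM : ∀ j, τ j ∈ M := by
    intro j
    refine Submodule.subset_span
      ⟨fun i => ⟨if i = j then 1 else 0, by split_ifs <;> omega⟩, ?_⟩
    simp [pow_ite, Finset.prod_ite_eq']
  rw [Algebra.adjoin_eq_span]
  apply le_antisymm
  · rw [Submodule.span_le]
    intro x hx
    induction hx using Submonoid.closure_induction with
    | mem x hx =>
      obtain ⟨j, rfl⟩ := hx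
      exact hτM j
    | one => exact h1
    | mul x y _ _ hx hy => exact hMM (Submodule.mul_mem_mul hx hy)
  · rw [Submodule.span_le]
    rintro _ ⟨e, rfl⟩
    refine Submodule.subset_span ?_
    exact prod_mem fun i _ => pow_mem (Submonoid.subset_closure (Set.mem_range_self i)) _

/-- Every element of `A[τ_1, …, τ_s] ⊆ Ω` is congruent to an element of `A` modulo any ideal
containing the generators `τ_i`. [folklore] -/
theorem rootOverring_exists_sub_algebraMap_mem {s : ℕ} (τ : Fin s → Ω)
    (I : Ideal (Algebra.adjoin A (Set.range τ)))
    (hI : ∀ i, (⟨τ i, Algebra.subset_adjoin ⟨i, rfl⟩⟩ : Algebra.adjoin A (Set.range τ)) ∈ I)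
    (b : Algebra.adjoin A (Set.range τ)) :
    ∃ a : A, b - algebraMap A (Algebra.adjoin A (Set.range τ)) a ∈ I := by
  have hb : b ∈ Algebra.adjoin A
      (((↑) : Algebra.adjoin A (Set.range τ) → Ω) ⁻¹' Set.range τ) := by
    rw [Algebra.adjoin_adjoin_coe_preimage]
    exact Algebra.mem_top
  induction hb using Algebra.adjoin_induction with
  | mem x hx =>
    obtain ⟨i, hi⟩ := hx
    refine ⟨0, ?_⟩
    rw [map_zero, sub_zero]
    have hxi : x = ⟨τ i, Algebra.subset_adjoin ⟨i, rfl⟩⟩ := Subtype.ext hi.symm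
    rw [hxi]
    exact hI i
  | algebraMap r => exact ⟨r, by rw [sub_self]; exact I.zero_mem⟩
  | add x y _ _ hx hy =>
    obtain ⟨a, ha⟩ := hx
    obtain ⟨c, hc⟩ := hy
    refine ⟨a + c, ?_⟩
    have heq : x + y - algebraMap A _ (a + c) =
        (x - algebraMap A _ a) + (y - algebraMap A _ c) := by
      rw [map_add]; ring
    rw [heq]
    exact I.add_mem ha hc
  | mul x y _ _ hx hy =>
    obtain ⟨a, ha⟩ := hx
    obtain ⟨c, hc⟩ := hy
    refine ⟨a * c, ?_⟩
    have heq : x * y - algebraMap A _ (a * c) =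
        x * (y - algebraMap A _ c) + (x - algebraMap A _ a) * algebraMap A _ c := by
      rw [map_mul]; ring
    rw [heq]
    exact I.add_mem (I.mul_mem_left _ hc) (I.mul_mem_right _ ha)

/-- **The maximal ideal of the root overring.** Let `(A, 𝔪)` be local, `𝔪 = (tw₁, …, tw_d)`,
`ι : Fin s ↪ Fin d`, `τ_i ∈ Ω` with `τ_i^p = tw (ι i)` (`p ≥ 1`), and assume
`Ã = A[τ_1, …, τ_s] ⊆ Ω` is integral over `A`. Then every maximal ideal of `Ã` is the ideal
generated by the `d` elements `τ_i` (`i < s`) and `tw_k` (`k ∉ ι`) (listed as the family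
`Function.extend ι τ (tw)` indexed by `Fin d`). [folklore] -/
theorem rootOverring_eq_span_of_isMaximal [IsLocalRing A] {p s d : ℕ} (hp : 0 < p)
    (tw : Fin d → A) (hspan : Ideal.span (Set.range tw) = maximalIdeal A) (ι : Fin s → Fin d)
    (hι : Function.Injective ι) (τ : Fin s → Ω) (hτ : ∀ i, τ i ^ p = algebraMap A Ω (tw (ι i)))
    [Algebra.IsIntegral A (Algebra.adjoin A (Set.range τ))]
    (M : Ideal (Algebra.adjoin A (Set.range τ))) (hM : M.IsMaximal) :
    M = Ideal.span (Set.range (Function.extend ι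
      (fun i => (⟨τ i, Algebra.subset_adjoin ⟨i, rfl⟩⟩ : Algebra.adjoin A (Set.range τ)))
      fun k => algebraMap A (Algebra.adjoin A (Set.range τ)) (tw k))) := by
  revert M
  set B : Subalgebra A Ω := Algebra.adjoin A (Set.range τ)
  set τB : Fin s → B := fun i => ⟨τ i, Algebra.subset_adjoin ⟨i, rfl⟩⟩
  set g : Fin d → B := Function.extend ι τB fun k => algebraMap A B (tw k)
  intro M hM
  haveI := hM
  have hMc : M.comap (algebraMap A B) = maximalIdeal A :=
    IsLocalRing.eq_maximalIdeal (Ideal.isMaximal_comap_of_isIntegral_of_isMaximal (R := A) M)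
  have hmM : ∀ a ∈ maximalIdeal A, algebraMap A B a ∈ M := fun a ha => by
    rw [← Ideal.mem_comap, hMc]
    exact ha
  have htw : ∀ k, tw k ∈ maximalIdeal A := fun k => hspan ▸ Ideal.subset_span ⟨k, rfl⟩
  have hpow : ∀ i, τB i ^ p = algebraMap A B (tw (ι i)) := fun i =>
    Subtype.ext (by rw [SubmonoidClass.coe_pow]; exact hτ i)
  have hgι : ∀ i, g (ι i) = τB i := fun i => hι.extend_apply _ _ i
  have hgn : ∀ k, (¬ ∃ i, ι i = k) → g k = algebraMap A B (tw k) := fun k hk =>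
    Function.extend_apply' _ _ k hk
  -- `I ≤ M`
  have hIM : Ideal.span (Set.range g) ≤ M := by
    rw [Ideal.span_le]
    rintro _ ⟨k, rfl⟩
    by_cases hk : ∃ i, ι i = k
    · obtain ⟨i, rfl⟩ := hk
      rw [SetLike.mem_coe, hgι]
      exact hM.isPrime.mem_of_pow_mem p (by rw [hpow]; exact hmM _ (htw _))
    · rw [SetLike.mem_coe, hgn k hk]
      exact hmM _ (htw k)
  -- the generators and `𝔪 Ã` lie in `I`
  have hτI : ∀ i, τB i ∈ Ideal.span (Set.range g) := fun i => by
    rw [← hgι i]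
    exact Ideal.subset_span ⟨ι i, rfl⟩
  have htwI : ∀ k, algebraMap A B (tw k) ∈ Ideal.span (Set.range g) := by
    intro k
    by_cases hk : ∃ i, ι i = k
    · obtain ⟨i, rfl⟩ := hk
      rw [← hpow]
      exact Ideal.pow_mem_of_mem _ (hτI i) p hp
    · rw [← hgn k hk]
      exact Ideal.subset_span ⟨k, rfl⟩
  have hmI : ∀ a ∈ maximalIdeal A, algebraMap A B a ∈ Ideal.span (Set.range g) := by
    have hle : (maximalIdeal A).map (algebraMap A B) ≤ Ideal.span (Set.range g) := by
      rw [← hspan, Ideal.map_span, Ideal.span_le]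
      rintro _ ⟨_, ⟨k, rfl⟩, rfl⟩
      exact htwI k
    exact fun a ha => hle (Ideal.mem_map_of_mem _ ha)
  -- `M ≤ I`
  refine le_antisymm (fun x hx => ?_) hIM
  obtain ⟨a, ha⟩ := rootOverring_exists_sub_algebraMap_mem τ _ hτI x
  have haM : algebraMap A B a ∈ M := by
    have h := M.sub_mem hx (hIM ha)
    rwa [sub_sub_cancel] at h
  have ha' : a ∈ maximalIdeal A := by
    rw [← hMc, Ideal.mem_comap]
    exact haM
  have h := (Ideal.span (Set.range g)).add_mem ha (hmI a ha')
  rwa [sub_add_cancel] at h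

/-- STUB (the `p`-th root overring is regular). Let `A` be a regular local ring of prime characteristic
`p`, embedded in a field `Ω`, `tw₁ … tw_d` a minimal system of generators of `𝔪_A` (`d = dim A`),
`t_i = tw (ι i)` (`ι : Fin s ↪ Fin d`) some of them, and `τ_i ∈ Ω` with `τ_i^p = t_i`. Then
`Ã = A[τ_1, …, τ_s] ⊆ Ω` is a regular local ring (it is finite over `A`, local with maximal ideal
`(τ_1..τ_s, tw_k : k ∉ ι)` — `d` generators — and `dim Ã = dim A = d`), hence an integrally closed domain,
and as an `A`-module it is spanned by the monomials `∏ τ_i^{e_i}`, `0 ≤ e_i < p`. [folklore] -/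
theorem stub_rootOverring {A Ω : Type} [CommRing A] [IsRegularLocalRing A] [Field Ω] [Algebra A Ω]
    (hinj : Function.Injective (algebraMap A Ω)) (p : ℕ) (hp : p.Prime) [CharP A p]
    (s d : ℕ) (tw : Fin d → A) (hspan : Ideal.span (Set.range tw) = maximalIdeal A)
    (hdim : ringKrullDim A = (d : WithBot ℕ∞)) (ι : Fin s → Fin d) (hι : Function.Injective ι)
    (τ : Fin s → Ω) (hτ : ∀ i, τ i ^ p = algebraMap A Ω (tw (ι i))) :
    IsRegularLocalRing (Algebra.adjoin A (Set.range τ)) ∧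
      IsIntegrallyClosed (Algebra.adjoin A (Set.range τ)) ∧
      Module.Finite A (Algebra.adjoin A (Set.range τ)) ∧
      Subalgebra.toSubmodule (Algebra.adjoin A (Set.range τ)) =
        Submodule.span A (Set.range fun e : Fin s → Fin p => ∏ i, τ i ^ (e i : ℕ)) := by
  classical
  set B : Subalgebra A Ω := Algebra.adjoin A (Set.range τ)
  set τB : Fin s → B := fun i => ⟨τ i, Algebra.subset_adjoin ⟨i, rfl⟩⟩
  set g : Fin d → B := Function.extend ι τB fun k => algebraMap A B (tw k)
  -- (1) monomial span and finiteness
  have hspanB := rootOverring_toSubmodule_eq_span p hp (fun i => tw (ι i)) τ hτ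
  have hfin : Module.Finite A B := by
    have hfg : (Subalgebra.toSubmodule B).FG := by
      rw [hspanB]
      exact Submodule.fg_span (Set.finite_range _)
    exact Module.Finite.of_fg hfg
  haveI := hfin
  haveI : Algebra.IsIntegral A B := Algebra.IsIntegral.of_finite A B
  haveI : IsNoetherianRing B :=
    isNoetherianRing_of_fg (Subalgebra.fg_def.mpr ⟨Set.range τ, Set.finite_range τ, rfl⟩)
  have hinjB : Function.Injective (algebraMap A B) := fun a b hab =>
    hinj (congrArg Subtype.val hab)
  -- (2) dimension
  have hdimB : ringKrullDim B = d := by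
    rw [← Literature.RingTheory.KrullDimension.ringKrullDim_eq_of_isIntegral hinjB, hdim]
  -- (3) `B` is local with maximal ideal `(g)`
  have hMeq : ∀ M : Ideal B, M.IsMaximal → M = Ideal.span (Set.range g) := fun M hM =>
    rootOverring_eq_span_of_isMaximal hp.pos tw hspan ι hι τ hτ M hM
  obtain ⟨M₀, hM₀⟩ := Ideal.exists_maximal B
  haveI : IsLocalRing B := IsLocalRing.of_unique_max_ideal
    ⟨M₀, hM₀, fun M hM => (hMeq M hM).trans (hMeq M₀ hM₀).symm⟩
  have hmax : maximalIdeal B = Ideal.span (Set.range g) := hMeq _ (maximalIdeal.isMaximal B)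
  -- (4) regularity: `d` generators against `dim B = d`
  have hreg : IsRegularLocalRing B := by
    refine IsRegularLocalRing.of_spanFinrank_maximalIdeal_le B ?_
    rw [hdimB, hmax]
    have h1 : (Ideal.span (Set.range g)).spanFinrank ≤ d := by
      refine (Submodule.spanFinrank_span_le_ncard_of_finite (Set.finite_range g)).trans ?_
      calc (Set.range g).ncard ≤ (Finset.univ.image g).card := by
            rw [← Set.ncard_coe_finset, Finset.coe_image, Finset.coe_univ, Set.image_univ]
        _ ≤ Finset.univ.card := Finset.card_image_le
        _ = d := by simp
    exact_mod_cast h1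
  haveI := hreg
  exact ⟨hreg, Literature.AlgebraicGeometry.Resolution.isIntegrallyClosed_of_isRegularLocalRing B,
    hfin, hspanB⟩

end Summit.ResolutionOfSingularities.ResolutionOfSingularities.Theorems.RadicialJung.CleanModelsSuffice

end
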